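import Summits.QuantumFields.YangMills.Theorems.BalabanUVNodesN21InteriorLocalBg
import Summits.QuantumFields.YangMills.Theorems.BalabanUVNodesN21ThresholdMixtureRStepMarginals

/-!
# N21 (NE7c), strategy s3 «alternative currency», file 36 — FILE 32 GENERIC IN THE DATUM FAMILY: the mixture road's ℝ-step identities ((0.4) per summand,
# post-ℝ weight = pre-ℝ weight, the (N)∕(Eoff) marginal identity) at the tested statistics of ANY family `𝔟` carrying the two displayed clauses (H-L)
# `InteriorLocalBg` (35) and (H-U) `LocalBgMeasurableBg` (def-R FILE 19) — so that at the measurable family `𝔟ᴺᴹ` (34b), where BOTH are theorems, (LOC),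
# (DISJ) AND (H-U) are no longer hypotheses

HEADER — WORK-UNIT METADATA.  Seat `pub-ymgap-dag-n21-e` (R141 (C) fan-out, node N21 = NE7c `T4IndicatorShell.ShellWeightBound`, strategy s3), g11, file 36;
sequel of 35 (`…N21InteriorLocalBg`) and 32 (`…N21RStepMarginalsBgN`, whose statements these are with `normalise (bgFamOfRecord …) _ ↦ 𝔟 K k` and the per-cube
`hU` ↦ the family clause).  Lane: `--kind proof --supports stmt-QuantumFields-20544 --as helper` (K3⁷ `SpineGivenEndpointR13SepCoPH`).  Count-neutral.

THE CONTENT.  For a datum family `𝔟 : BgFam F N` with (H-L) `InteriorLocalBg F N ν 𝔟` and (H-U) `LocalBgMeasurableBg F N ν 𝔟`: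
§1 `measurable_recordStatBg` — the tested statistic `stat_□(V) = sup_{p ⊂ □^∼} |U_{k,□}(V)(∂p) − 1|` is measurable (13a `measurable_iSup_dist1`).
§2 ★ `integral_rstepSummand_eq_bgIL` — file 21's (0.4) per summand at `u := stat`: for a fibre `fib ⊆ bondsMeeting k Z`, cube families `A″ ⊆ A` with every
   `□ ∈ A` far from `Z` (`□^{≈7} ∩ Z = ∅`), polarities agreeing on `A″`, provisos on the factor-free parts: `∫ normTerm(fib)(c″f″)(c f) dV = ∫ c f dV`;
   ★ `rstepWeight_eq_bgIL` — the same at every threshold vector for `S`-dependent slots.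
§3 ★★ `map_rstepSummand_eq_bgIL` — file 23's (N)∕(Eoff): for every measurable fibre-independent statistic `w`, `(dV·normTerm(fib)(c″f″)(c f)).map w =
   (dV·(c f)).map w`; ★★ `map_rstepSummand_eq_bgIL_fibOfSeq` — at def-R's fibre `fibOfSeq …` ∕ `Z′(sq) = zpOfSeq …`.
Binders left at a family with both clauses PROVED (34b's `𝔟ᴺᴹ`): the telescope provisos `TermProvisos fib f″ f C`, the numerics `0 < k ≤ m + K`, `1 ≤ M₁`,
`1 ≤ M₂`, `L·M₁ ≤ L^{k+1}M₂R_k`, and the geometry `□^{≈7} ∩ Z = ∅` on `A` (which cubes are OFF).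

HONEST FRAMING.  NE7c is NOT PRINTED and NOT PROVED.  [folklore] bookkeeping: file 32's three applications with 35's generic `huI` and the family clause (H-U).
Nothing of Bałaban's asserted; N21 NOT discharged; counts UNMOVED (typed 28∕28 · discharged 5∕27); count-neutral; one finite 𝕋⁴ at fixed `ε`; NOT ℝ⁴ ∕ OS ∕
mass gap ∕ Clay.  No `sorry`, no `axiom`, no `instance`, no `notation`.

CITATION HEADER (lean-in-tree rule 2026-08-18).  BY NAME: 35 `InteriorLocalBg` ∕ `fibreIndep_recordStatBg_of_far`; 31 `mem_bondsMeeting_of_mem_fibOfSeq`; 21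
`integral_rstepSummand_eq` ∕ `rstepWeight_eq` ∕ `fibreIndep_prod_fac_smallInd` ∕ `prod_fac_smallInd_le_of_subset` ∕ `measurable_prod_fac_smallInd_field`; 13
`prod_fac_smallInd_mem_unitInterval`; 23 `map_withDensity_rstepSummand_eq_of_le`; 13a `measurable_iSup_dist1`; def-R `Node00.BgFam` ∕ `LocalBgMeasurableBg` ∕
`cubeEnl` ∕ `cubeSide` ∕ `cubeIndices` ∕ `RkOfRecord` ∕ `bondsMeeting` ∕ `fibOfSeq` ∕ `zpOfSeq`; b01 `B15.BasicStep.normTerm`; `T4ObservableTelescope.TermProvisos`;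
`T4DressedR.FibreIndep`; `T4IndicatorShell.smallInd`; `T4LipschitzLedger.Pol`; `Setup.fieldMeasure`; r11 `B14.Eq216Concrete.ukBox`.  Context only (SHAPE, nothing
asserted): [Balaban1989LargeFieldI] (0.3)–(0.4) p. 176, (1.1) p. 177; [Balaban1988Convergent] (2.16)–(2.18) p. 257.
-/

set_option autoImplicit false

noncomputable section

open MeasureTheory Set
open scoped BigOperators ENNReal

namespace Summit.QuantumFields.YangMills.Theorems.N21RStepMarginalsBgIL

open Literature.MathematicalPhysics.QuantumFieldTheory.Balaban1983to89
open Literature.MathematicalPhysics.QuantumFieldTheory.Balaban1983to89.Node00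
open T4Continuum B15DeterminingSets B14.Eq213DetSet B14.Eq216Concrete B14.Eq12InteriorLocality B14.Eq213MaximalDomains B15Eq112TorusCover
  B14DomainGeom B14.Eq218Concrete
open Literature.MathematicalPhysics.QuantumFieldTheory.Balaban1983to89.B15.BasicStep (normTerm)
open Literature.MathematicalPhysics.QuantumFieldTheory.Balaban1983to89.T4DressedR (FibreIndep)
open Literature.MathematicalPhysics.QuantumFieldTheory.Balaban1983to89.T4ObservableTelescope (TermProvisos)
open Literature.MathematicalPhysics.QuantumFieldTheory.Balaban1983to89.T4IndicatorShell (smallInd)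
open Literature.MathematicalPhysics.QuantumFieldTheory.Balaban1983to89.T4LipschitzLedger (Pol)
open Summit.QuantumFields.YangMills.Theorems.N21ThresholdMixtureRecordChi (measurable_iSup_dist1)
open Summit.QuantumFields.YangMills.Theorems.N21ThresholdMixtureTStepChi (prod_fac_smallInd_mem_unitInterval)
open Summit.QuantumFields.YangMills.Theorems.N21ThresholdMixtureRStepCommonBox (fibreIndep_prod_fac_smallInd prod_fac_smallInd_le_of_subset
  measurable_prod_fac_smallInd_field integral_rstepSummand_eq rstepWeight_eq)
open Summit.QuantumFields.YangMills.Theorems.N21ThresholdMixtureRStepMarginals (map_withDensity_rstepSummand_eq_of_le)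
open Summit.QuantumFields.YangMills.Theorems.N21ReadSetDisj (mem_bondsMeeting_of_mem_fibOfSeq)
open Summit.QuantumFields.YangMills.Theorems.N21InteriorLocalBg (InteriorLocalBg fibreIndep_recordStatBg_of_far)

variable (F : T4Family) (N : ℕ) [NeZero N]

/-! ## §1 The tested statistic of a cube is measurable under (H-U) -/

/-- Under the family clause (H-U) `LocalBgMeasurableBg`, the tested statistic `stat_□(V) = sup_{p ⊂ □^∼} |U_{k,□}(V)(∂p) − 1|` of every cube is measurable
(13a `measurable_iSup_dist1`). [cite: Balaban1988Convergent, (2.16)–(2.17) p.257 (bookkeeping)] -/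
theorem measurable_recordStatBg {𝔟 : BgFam F N} (ν : Stage7Numerics) (hU : LocalBgMeasurableBg F N ν 𝔟) (g : ℕ → ℝ) (K k : ℕ) (a : Pt (F.P K).d) :
    Measurable fun V : GaugeField (F.P K) k (SU N) =>
      ⨆ p : ↥(plaqInside (cubeEnl (F.P K) (cubeSide (F.P K).L ν.M₂ (RkOfRecord (F.P K).L ν.r (g k)) k) a 1)),
        dist1 (GaugeField.plaqHol (ukBox (𝔟 K k) ν.M₁ (cubeEnl (F.P K) (cubeSide (F.P K).L ν.M₂ (RkOfRecord (F.P K).L ν.r (g k)) k) a 4) k V) p.1) :=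
  (measurable_iSup_dist1 _).comp (hU K k _)

/-! ## §2 File 21's (0.4) per summand ∕ per threshold vector at the tested statistics of `𝔟` -/

/-- ★ **(0.4) PER SUMMAND AT AN INTERIOR-LOCAL MEASURABLE FAMILY** (21 `integral_rstepSummand_eq` at `u := stat`): for a fibre `fib ⊆ bondsMeeting k Z`, cube
families `A″ ⊆ A` with EVERY `□ ∈ A` FAR FROM `Z` (`□^{≈7} ∩ Z = ∅`), polarities agreeing on `A″` and provisos on the factor-free parts, the post-ℝ summand has the
sender's sharp mass at every threshold vector `S`.  Binders: (H-L), (H-U), `0 < k ≤ m + K`, `1 ≤ M₁`, `1 ≤ M₂`, `L·M₁ ≤ L^{k+1}M₂R_k`.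
[cite: Balaban1989LargeFieldI, (0.4) p.176; Balaban1988Convergent, (2.16)–(2.18) p.257] -/
theorem integral_rstepSummand_eq_bgIL {𝔟 : BgFam F N} (ν : Stage7Numerics) (hL : InteriorLocalBg F N ν 𝔟) (hU : LocalBgMeasurableBg F N ν 𝔟)
    (g : ℕ → ℝ) (K k : ℕ) [DecidableEq (PBond (F.P K) k)]
    (hk : k ≤ (F.P K).m + (F.P K).K) (hk0 : 0 < k) (hM : 1 ≤ ν.M₁) (hM₂ : 1 ≤ ν.M₂)
    (hnum : (F.P K).L * ν.M₁ ≤ cubeSide (F.P K).L ν.M₂ (RkOfRecord (F.P K).L ν.r (g k)) k)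
    (Z : Set (Site (F.P K) 0)) (fib : Finset (PBond (F.P K) k)) (hfib : ∀ b ∈ fib, b ∈ bondsMeeting k Z)
    {A A'' : Finset ↥(cubeIndices (F.P K) (cubeSide (F.P K).L ν.M₂ (RkOfRecord (F.P K).L ν.r (g k)) k))} (hsub : A'' ⊆ A)
    (hA : ∀ c ∈ A, ∀ z ∈ Z, z ∉ cubeEnl (F.P K) (cubeSide (F.P K).L ν.M₂ (RkOfRecord (F.P K).L ν.r (g k)) k) c 7)
    (pol pol'' : ↥(cubeIndices (F.P K) (cubeSide (F.P K).L ν.M₂ (RkOfRecord (F.P K).L ν.r (g k)) k)) → Pol) (hpol : ∀ c ∈ A'', pol'' c = pol c)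
    {f f'' : Density (F.P K) k (SU N)} {C : ℝ} (hP : TermProvisos fib f'' f C)
    (S : ↥(cubeIndices (F.P K) (cubeSide (F.P K).L ν.M₂ (RkOfRecord (F.P K).L ν.r (g k)) k)) → ℝ) :
    ∫ V, normTerm fib
        (fun U => (∏ c ∈ A'', (pol'' c).fac (smallInd
          (⨆ p : ↥(plaqInside (cubeEnl (F.P K) (cubeSide (F.P K).L ν.M₂ (RkOfRecord (F.P K).L ν.r (g k)) k) c 1)),
            dist1 (GaugeField.plaqHol (ukBox (𝔟 K k) ν.M₁
              (cubeEnl (F.P K) (cubeSide (F.P K).L ν.M₂ (RkOfRecord (F.P K).L ν.r (g k)) k) c 4) k U) p.1)) (S c))) * f'' U)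
        (fun U => (∏ c ∈ A, (pol c).fac (smallInd
          (⨆ p : ↥(plaqInside (cubeEnl (F.P K) (cubeSide (F.P K).L ν.M₂ (RkOfRecord (F.P K).L ν.r (g k)) k) c 1)),
            dist1 (GaugeField.plaqHol (ukBox (𝔟 K k) ν.M₁
              (cubeEnl (F.P K) (cubeSide (F.P K).L ν.M₂ (RkOfRecord (F.P K).L ν.r (g k)) k) c 4) k U) p.1)) (S c))) * f U) V
        ∂fieldMeasure (F.P K) k (SU N)
      = ∫ V, (∏ c ∈ A, (pol c).fac (smallInd
          (⨆ p : ↥(plaqInside (cubeEnl (F.P K) (cubeSide (F.P K).L ν.M₂ (RkOfRecord (F.P K).L ν.r (g k)) k) c 1)),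
            dist1 (GaugeField.plaqHol (ukBox (𝔟 K k) ν.M₁
              (cubeEnl (F.P K) (cubeSide (F.P K).L ν.M₂ (RkOfRecord (F.P K).L ν.r (g k)) k) c 4) k V) p.1)) (S c))) * f V
        ∂fieldMeasure (F.P K) k (SU N) :=
  integral_rstepSummand_eq fib hsub pol pol'' hpol
    (u := fun c V => ⨆ p : ↥(plaqInside (cubeEnl (F.P K) (cubeSide (F.P K).L ν.M₂ (RkOfRecord (F.P K).L ν.r (g k)) k) c 1)),
      dist1 (GaugeField.plaqHol (ukBox (𝔟 K k) ν.M₁ (cubeEnl (F.P K) (cubeSide (F.P K).L ν.M₂ (RkOfRecord (F.P K).L ν.r (g k)) k) c 4) k V) p.1))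
    (fun c hc => fibreIndep_recordStatBg_of_far F N ν hL g K k hk hk0 hM hM₂ hnum c Z fib hfib (hA c hc))
    (fun c _ => measurable_recordStatBg F N ν hU g K k c.1) hP S

/-- ★ **POST-ℝ WEIGHT = PRE-ℝ WEIGHT AT EVERY THRESHOLD VECTOR** (21 `rstepWeight_eq` at `u := stat`), for slots that may themselves depend on the threshold
vector, with threshold-free provisos at each `S`; same far-cube geometry, (H-L), (H-U). [cite: Balaban1989LargeFieldI, (0.4) p.176; Balaban1988Convergent, (2.17)–(2.18) p.257] -/
theorem rstepWeight_eq_bgIL {Θ : Type*} {𝔟 : BgFam F N} (ν : Stage7Numerics) (hL : InteriorLocalBg F N ν 𝔟) (hU : LocalBgMeasurableBg F N ν 𝔟)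
    (g : ℕ → ℝ) (K k : ℕ) [DecidableEq (PBond (F.P K) k)]
    (hk : k ≤ (F.P K).m + (F.P K).K) (hk0 : 0 < k) (hM : 1 ≤ ν.M₁) (hM₂ : 1 ≤ ν.M₂)
    (hnum : (F.P K).L * ν.M₁ ≤ cubeSide (F.P K).L ν.M₂ (RkOfRecord (F.P K).L ν.r (g k)) k)
    (Z : Set (Site (F.P K) 0)) (fib : Finset (PBond (F.P K) k)) (hfib : ∀ b ∈ fib, b ∈ bondsMeeting k Z)
    {A A'' : Finset ↥(cubeIndices (F.P K) (cubeSide (F.P K).L ν.M₂ (RkOfRecord (F.P K).L ν.r (g k)) k))} (hsub : A'' ⊆ A)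
    (hA : ∀ c ∈ A, ∀ z ∈ Z, z ∉ cubeEnl (F.P K) (cubeSide (F.P K).L ν.M₂ (RkOfRecord (F.P K).L ν.r (g k)) k) c 7)
    (pol pol'' : ↥(cubeIndices (F.P K) (cubeSide (F.P K).L ν.M₂ (RkOfRecord (F.P K).L ν.r (g k)) k)) → Pol) (hpol : ∀ c ∈ A'', pol'' c = pol c)
    (fS f''S : Θ → Density (F.P K) k (SU N)) {C : ℝ} (hP : ∀ S, TermProvisos fib (f''S S) (fS S) C)
    (thr : Θ → ↥(cubeIndices (F.P K) (cubeSide (F.P K).L ν.M₂ (RkOfRecord (F.P K).L ν.r (g k)) k)) → ℝ) (S : Θ) :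
    ∫ V, normTerm fib
        (fun U => (∏ c ∈ A'', (pol'' c).fac (smallInd
          (⨆ p : ↥(plaqInside (cubeEnl (F.P K) (cubeSide (F.P K).L ν.M₂ (RkOfRecord (F.P K).L ν.r (g k)) k) c 1)),
            dist1 (GaugeField.plaqHol (ukBox (𝔟 K k) ν.M₁
              (cubeEnl (F.P K) (cubeSide (F.P K).L ν.M₂ (RkOfRecord (F.P K).L ν.r (g k)) k) c 4) k U) p.1)) (thr S c))) * f''S S U)
        (fun U => (∏ c ∈ A, (pol c).fac (smallInd
          (⨆ p : ↥(plaqInside (cubeEnl (F.P K) (cubeSide (F.P K).L ν.M₂ (RkOfRecord (F.P K).L ν.r (g k)) k) c 1)),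
            dist1 (GaugeField.plaqHol (ukBox (𝔟 K k) ν.M₁
              (cubeEnl (F.P K) (cubeSide (F.P K).L ν.M₂ (RkOfRecord (F.P K).L ν.r (g k)) k) c 4) k U) p.1)) (thr S c))) * fS S U) V
        ∂fieldMeasure (F.P K) k (SU N)
      = ∫ V, (∏ c ∈ A, (pol c).fac (smallInd
          (⨆ p : ↥(plaqInside (cubeEnl (F.P K) (cubeSide (F.P K).L ν.M₂ (RkOfRecord (F.P K).L ν.r (g k)) k) c 1)),
            dist1 (GaugeField.plaqHol (ukBox (𝔟 K k) ν.M₁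
              (cubeEnl (F.P K) (cubeSide (F.P K).L ν.M₂ (RkOfRecord (F.P K).L ν.r (g k)) k) c 4) k V) p.1)) (thr S c))) * fS S V
        ∂fieldMeasure (F.P K) k (SU N) :=
  rstepWeight_eq fib hsub pol pol'' hpol
    (u := fun c V => ⨆ p : ↥(plaqInside (cubeEnl (F.P K) (cubeSide (F.P K).L ν.M₂ (RkOfRecord (F.P K).L ν.r (g k)) k) c 1)),
      dist1 (GaugeField.plaqHol (ukBox (𝔟 K k) ν.M₁ (cubeEnl (F.P K) (cubeSide (F.P K).L ν.M₂ (RkOfRecord (F.P K).L ν.r (g k)) k) c 4) k V) p.1))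
    (fun c hc => fibreIndep_recordStatBg_of_far F N ν hL g K k hk hk0 hM hM₂ hnum c Z fib hfib (hA c hc))
    (fun c _ => measurable_recordStatBg F N ν hU g K k c.1) fS f''S hP thr S

/-! ## §3 File 23's (N)∕(Eoff) marginal identity at the tested statistics of `𝔟` -/

/-- ★★ **THE (N)∕(Eoff) BINDER OF THE RESAMPLING TOWER AT THE CURRENT FIELD FOR AN INTERIOR-LOCAL MEASURABLE FAMILY** (23
`map_withDensity_rstepSummand_eq_of_le` at `c := ∏_{A} …`, `c″ := ∏_{A″} …`, `u := stat`): for a fibre `fib ⊆ bondsMeeting k Z`, cube families `A″ ⊆ A` far from `Z`,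
agreeing polarities on `A″`, provisos, and every measurable fibre-independent statistic `w`, the `w`-marginal of the post-ℝ summand's law equals the `w`-marginal of the
sender's law.  Binders: (H-L), (H-U), `0 < k ≤ m + K`, `1 ≤ M₁`, `1 ≤ M₂`, `L·M₁ ≤ L^{k+1}M₂R_k`. [cite: Balaban1989LargeFieldI, (0.3)–(0.4) p.176; Balaban1988Convergent, (2.16)–(2.18) p.257] -/
theorem map_rstepSummand_eq_bgIL {𝔟 : BgFam F N} (ν : Stage7Numerics) (hL : InteriorLocalBg F N ν 𝔟) (hU : LocalBgMeasurableBg F N ν 𝔟)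
    (g : ℕ → ℝ) (K k : ℕ) [DecidableEq (PBond (F.P K) k)]
    (hk : k ≤ (F.P K).m + (F.P K).K) (hk0 : 0 < k) (hM : 1 ≤ ν.M₁) (hM₂ : 1 ≤ ν.M₂)
    (hnum : (F.P K).L * ν.M₁ ≤ cubeSide (F.P K).L ν.M₂ (RkOfRecord (F.P K).L ν.r (g k)) k)
    (Z : Set (Site (F.P K) 0)) (fib : Finset (PBond (F.P K) k)) (hfib : ∀ b ∈ fib, b ∈ bondsMeeting k Z)
    {A A'' : Finset ↥(cubeIndices (F.P K) (cubeSide (F.P K).L ν.M₂ (RkOfRecord (F.P K).L ν.r (g k)) k))} (hsub : A'' ⊆ A)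
    (hA : ∀ c ∈ A, ∀ z ∈ Z, z ∉ cubeEnl (F.P K) (cubeSide (F.P K).L ν.M₂ (RkOfRecord (F.P K).L ν.r (g k)) k) c 7)
    (pol pol'' : ↥(cubeIndices (F.P K) (cubeSide (F.P K).L ν.M₂ (RkOfRecord (F.P K).L ν.r (g k)) k)) → Pol) (hpol : ∀ c ∈ A'', pol'' c = pol c)
    {f f'' : Density (F.P K) k (SU N)} {C : ℝ} (hP : TermProvisos fib f'' f C)
    (S : ↥(cubeIndices (F.P K) (cubeSide (F.P K).L ν.M₂ (RkOfRecord (F.P K).L ν.r (g k)) k)) → ℝ)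
    {w : GaugeField (F.P K) k (SU N) → ℝ} (hwm : Measurable w) (hw : FibreIndep fib w) :
    ((fieldMeasure (F.P K) k (SU N)).withDensity fun V => ENNReal.ofReal (normTerm fib
        (fun U => (∏ c ∈ A'', (pol'' c).fac (smallInd
          (⨆ p : ↥(plaqInside (cubeEnl (F.P K) (cubeSide (F.P K).L ν.M₂ (RkOfRecord (F.P K).L ν.r (g k)) k) c 1)),
            dist1 (GaugeField.plaqHol (ukBox (𝔟 K k) ν.M₁
              (cubeEnl (F.P K) (cubeSide (F.P K).L ν.M₂ (RkOfRecord (F.P K).L ν.r (g k)) k) c 4) k U) p.1)) (S c))) * f'' U)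
        (fun U => (∏ c ∈ A, (pol c).fac (smallInd
          (⨆ p : ↥(plaqInside (cubeEnl (F.P K) (cubeSide (F.P K).L ν.M₂ (RkOfRecord (F.P K).L ν.r (g k)) k) c 1)),
            dist1 (GaugeField.plaqHol (ukBox (𝔟 K k) ν.M₁
              (cubeEnl (F.P K) (cubeSide (F.P K).L ν.M₂ (RkOfRecord (F.P K).L ν.r (g k)) k) c 4) k U) p.1)) (S c))) * f U) V)).map w
      = ((fieldMeasure (F.P K) k (SU N)).withDensity fun V => ENNReal.ofReal ((∏ c ∈ A, (pol c).fac (smallInd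
          (⨆ p : ↥(plaqInside (cubeEnl (F.P K) (cubeSide (F.P K).L ν.M₂ (RkOfRecord (F.P K).L ν.r (g k)) k) c 1)),
            dist1 (GaugeField.plaqHol (ukBox (𝔟 K k) ν.M₁
              (cubeEnl (F.P K) (cubeSide (F.P K).L ν.M₂ (RkOfRecord (F.P K).L ν.r (g k)) k) c 4) k V) p.1)) (S c))) * f V)).map w := by
  -- the tested statistics of `𝔟`, their fibre-independence (35) and measurability ((H-U))
  set u : ↥(cubeIndices (F.P K) (cubeSide (F.P K).L ν.M₂ (RkOfRecord (F.P K).L ν.r (g k)) k)) → Density (F.P K) k (SU N) :=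
    fun c V => ⨆ p : ↥(plaqInside (cubeEnl (F.P K) (cubeSide (F.P K).L ν.M₂ (RkOfRecord (F.P K).L ν.r (g k)) k) c 1)),
      dist1 (GaugeField.plaqHol (ukBox (𝔟 K k) ν.M₁ (cubeEnl (F.P K) (cubeSide (F.P K).L ν.M₂ (RkOfRecord (F.P K).L ν.r (g k)) k) c 4) k V) p.1) with hu
  have huI : ∀ c ∈ A, FibreIndep fib (u c) := fun c hc =>
    fibreIndep_recordStatBg_of_far F N ν hL g K k hk hk0 hM hM₂ hnum c Z fib hfib (hA c hc)
  have hum : ∀ c ∈ A, Measurable (u c) := fun c _ => measurable_recordStatBg F N ν hU g K k c.1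
  exact map_withDensity_rstepSummand_eq_of_le fib hP
    (measurable_prod_fac_smallInd_field A pol hum S)
    (measurable_prod_fac_smallInd_field A'' pol'' (fun c hc => hum c (hsub hc)) S)
    (fibreIndep_prod_fac_smallInd fib A pol huI S) (fibreIndep_prod_fac_smallInd fib A'' pol'' (fun c hc => huI c (hsub hc)) S)
    (fun V => (prod_fac_smallInd_mem_unitInterval A pol (fun c => u c V) S).1)
    (fun V => (prod_fac_smallInd_mem_unitInterval A'' pol'' (fun c => u c V) S).1)
    (fun V => (prod_fac_smallInd_mem_unitInterval A pol (fun c => u c V) S).2)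
    (fun V => prod_fac_smallInd_le_of_subset hsub pol pol'' hpol (fun c => u c V) S) hwm hw

/-- ★★ **ONE APPLICATION AT def-R's FIBRE** (`fib := fibOfSeq F ν τ p g k sq`, `Z := Z′(sq) = zpOfSeq …`): the marginal identity of §3 for the (0.3) fibre of a
large-field sequence `sq`, on cube families far from `Z′(sq)`. [cite: Balaban1989LargeFieldI, (0.3)–(0.4) p.176, (1.1) p.177; Balaban1988Convergent, (2.16)–(2.18) p.257] -/
theorem map_rstepSummand_eq_bgIL_fibOfSeq {𝔟 : BgFam F N} (ν : Stage7Numerics) (hL : InteriorLocalBg F N ν 𝔟) (hU : LocalBgMeasurableBg F N ν 𝔟)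
    (τ : TowerNumerics) (p : B12.RunParams) (g : ℕ → ℝ) (k : ℕ) [DecidableEq (PBond (F.P p.K) k)]
    (hk : k ≤ (F.P p.K).m + (F.P p.K).K) (hk0 : 0 < k) (hM : 1 ≤ ν.M₁) (hM₂ : 1 ≤ ν.M₂)
    (hnum : (F.P p.K).L * ν.M₁ ≤ cubeSide (F.P p.K).L ν.M₂ (RkOfRecord (F.P p.K).L ν.r (g k)) k)
    (sq : SeqOfRecord F ν τ.M g p.K k)
    {A A'' : Finset ↥(cubeIndices (F.P p.K) (cubeSide (F.P p.K).L ν.M₂ (RkOfRecord (F.P p.K).L ν.r (g k)) k))} (hsub : A'' ⊆ A)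
    (hA : ∀ c ∈ A, ∀ z ∈ zpOfSeq F ν τ g p.K k sq, z ∉ cubeEnl (F.P p.K) (cubeSide (F.P p.K).L ν.M₂ (RkOfRecord (F.P p.K).L ν.r (g k)) k) c 7)
    (pol pol'' : ↥(cubeIndices (F.P p.K) (cubeSide (F.P p.K).L ν.M₂ (RkOfRecord (F.P p.K).L ν.r (g k)) k)) → Pol) (hpol : ∀ c ∈ A'', pol'' c = pol c)
    {f f'' : Density (F.P p.K) k (SU N)} {C : ℝ} (hP : TermProvisos (fibOfSeq F ν τ p g k sq) f'' f C)
    (S : ↥(cubeIndices (F.P p.K) (cubeSide (F.P p.K).L ν.M₂ (RkOfRecord (F.P p.K).L ν.r (g k)) k)) → ℝ)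
    {w : GaugeField (F.P p.K) k (SU N) → ℝ} (hwm : Measurable w) (hw : FibreIndep (fibOfSeq F ν τ p g k sq) w) :
    ((fieldMeasure (F.P p.K) k (SU N)).withDensity fun V => ENNReal.ofReal (normTerm (fibOfSeq F ν τ p g k sq)
        (fun U => (∏ c ∈ A'', (pol'' c).fac (smallInd
          (⨆ q : ↥(plaqInside (cubeEnl (F.P p.K) (cubeSide (F.P p.K).L ν.M₂ (RkOfRecord (F.P p.K).L ν.r (g k)) k) c 1)),
            dist1 (GaugeField.plaqHol (ukBox (𝔟 p.K k) ν.M₁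
              (cubeEnl (F.P p.K) (cubeSide (F.P p.K).L ν.M₂ (RkOfRecord (F.P p.K).L ν.r (g k)) k) c 4) k U) q.1)) (S c))) * f'' U)
        (fun U => (∏ c ∈ A, (pol c).fac (smallInd
          (⨆ q : ↥(plaqInside (cubeEnl (F.P p.K) (cubeSide (F.P p.K).L ν.M₂ (RkOfRecord (F.P p.K).L ν.r (g k)) k) c 1)),
            dist1 (GaugeField.plaqHol (ukBox (𝔟 p.K k) ν.M₁
              (cubeEnl (F.P p.K) (cubeSide (F.P p.K).L ν.M₂ (RkOfRecord (F.P p.K).L ν.r (g k)) k) c 4) k U) q.1)) (S c))) * f U) V)).map w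
      = ((fieldMeasure (F.P p.K) k (SU N)).withDensity fun V => ENNReal.ofReal ((∏ c ∈ A, (pol c).fac (smallInd
          (⨆ q : ↥(plaqInside (cubeEnl (F.P p.K) (cubeSide (F.P p.K).L ν.M₂ (RkOfRecord (F.P p.K).L ν.r (g k)) k) c 1)),
            dist1 (GaugeField.plaqHol (ukBox (𝔟 p.K k) ν.M₁
              (cubeEnl (F.P p.K) (cubeSide (F.P p.K).L ν.M₂ (RkOfRecord (F.P p.K).L ν.r (g k)) k) c 4) k V) q.1)) (S c))) * f V)).map w :=
  map_rstepSummand_eq_bgIL F N ν hL hU g p.K k hk hk0 hM hM₂ hnum (zpOfSeq F ν τ g p.K k sq) (fibOfSeq F ν τ p g k sq)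
    (fun _ hb => mem_bondsMeeting_of_mem_fibOfSeq F ν τ p g k sq hb) hsub hA pol pol'' hpol hP S hwm hw

end Summit.QuantumFields.YangMills.Theorems.N21RStepMarginalsBgIL

end
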